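import Mathlib
import Summits.CriticalPhenomena.PercolationContinuityZ3.Theorems.PercNearOneGluingAdditiveGluingGoodStepStar
import HarnessLib

/-! # Crux `PercNearOneGluing.AdditiveGluing` (stmt-CriticalPhenomena-4576), line `subuniform-dead-pocket-maximum` — towards `stub_goodStep`, II: the singleton branch

Helper file (siege on `stub_goodStep`, prover-siege-stmt-CriticalPhenomena-4576-stub_goodStep-32);
lands with `--supports stmt-CriticalPhenomena-4576`.

## Content

The branch `B = {x}` of Kozma–Nitzan's `σ_B`-decomposition at the observer `o` (arXiv:2401.12397,
proof of Theorem 5, p. 14: "there is no big difference between conditioning on `σ_{x}` and simply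
deleting `0`").  With the star of `o` PINNED to the single open pair `o–x` (weighting
`pinW w F ξ_{x}`, observer `o`) on one side and the star of `o` DELETED (weighting
`w⁰ e = if o ∈ e then 0 else w e`, observer `x`) on the other, the pieces of the good-quadruple
functional correspond exactly (`goodStep_transfer`: both are `μ_w` of one off-star event):
live failures (`goodStep_single_live`), connections between vertices other than `o`
(`goodStep_single_conn`), pockets `{C(o) = W} ↔ {C(x) = W ∖ {o}}` (`goodStep_single_pocket`; pockets
missing `x` are null, `goodStep_single_pocket_null`), avoidance factors (`goodStep_single_avoid`).
Re-indexing the pocket sum by `W ↦ W.erase o` gives `goodStep_single`: the pinned functional at the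
designated level `1 − μ(a₀ ↔ b)` is bounded by the star-deleted functional with observer `x` and
selection `W' ↦ sel (insert o W')` at the same level — the form in which the induction hypothesis of
`stub_goodStep` is consumed.  No new definitions.
-/

namespace Summit.CriticalPhenomena.PercolationContinuityZ3.Theorems

open MeasureTheory Set
open Literature.Probability.LatticeModels (prodBernoulli)
open Literature.Probability.Percolation (BondConfig openConn openConnIn openGraph openCluster
  openGraph_adj DeterminedBy determinedBy_iff PathIn pinW localCylinder)

noncomputable section
open Classical

variable {n : ℕ}

/-! ### D. The singleton branch `B = {x}`: transport between the pinned weighting (observer `o`,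
the pair `o–x` pinned open) and the star-deleted weighting (observer `x`) -/

/-- **Transfer principle.** If `X` agrees with an off-star event `X'` whenever the open star of
`o` is exactly `o–B`, and `Y` agrees with `X'` whenever the star of `o` is closed, then
`μ_{pin}(X) = μ_{w⁰}(Y)` (`pin` = star pinned to `o–B`, `w⁰` = star deleted): both equal
`μ_w(X')`. [folklore] -/
theorem goodStep_transfer (w : Sym2 (Fin n) → unitInterval) {o : Fin n} {B : Finset (Fin n)}
    {F : Finset (Sym2 (Fin n))} (hF : ∀ e, e ∈ F ↔ o ∈ e ∧ ¬ e.IsDiag)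
    {ξ : Set (Sym2 (Fin n))} (hξ : ∀ y : Fin n, s(o, y) ∈ ξ ↔ y ∈ B)
    {X X' Y : Set (BondConfig (Fin n))} (hX' : DeterminedBy X' ((({o} : Set (Fin n))ᶜ).sym2))
    (hpX : ∀ ω : BondConfig (Fin n), (∀ y : Fin n, y ≠ o → (s(o, y) ∈ ω ↔ y ∈ B)) → (ω ∈ X ↔ ω ∈ X'))
    (hdY : ∀ ω : BondConfig (Fin n), (∀ y : Fin n, y ≠ o → s(o, y) ∉ ω) → (ω ∈ Y ↔ ω ∈ X')) :
    (prodBernoulli (pinW w ↑F ξ)).real X =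
      (prodBernoulli (fun e : Sym2 (Fin n) => if o ∈ e then (0 : unitInterval) else w e)).real Y := by
  have h1 : (prodBernoulli (pinW w ↑F ξ)).real X = (prodBernoulli (pinW w ↑F ξ)).real X' := by
    refine measureReal_congr ?_
    filter_upwards [goodStep_pin_ae_star w hF hξ] with ω hω
    exact propext (hpX ω hω)
  have h2 : (prodBernoulli (pinW w ↑F ξ)).real X' = (prodBernoulli w).real X' :=
    Literature.Probability.LatticeModels.prodBernoulli_real_eq_of_determinedBy _ _
      (goodStep_pin_offstar w hF ξ) hX' MeasurableSet.of_discrete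
  have h3 : (prodBernoulli w).real X' =
      (prodBernoulli (fun e : Sym2 (Fin n) => if o ∈ e then (0 : unitInterval) else w e)).real X' :=
    Literature.Probability.LatticeModels.prodBernoulli_real_eq_of_determinedBy _ _
      (goodStep_del_offstar w o) hX' MeasurableSet.of_discrete
  have h4 : (prodBernoulli (fun e : Sym2 (Fin n) => if o ∈ e then (0 : unitInterval) else w e)).real X' =
      (prodBernoulli (fun e : Sym2 (Fin n) => if o ∈ e then (0 : unitInterval) else w e)).real Y := by
    refine measureReal_congr ?_
    filter_upwards [goodStep_del_ae_isolated w o] with ω hω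
    exact propext (hdY ω hω).symm
  rw [h1, h2, h3, h4]

/-- Pinned to the single pair `o–x`: the live failure of the observer `o` is the live failure
of `x` in the star-deleted graph. [cite: KozmaNitzan2024, §3.2 p. 14 (proof of Thm 5)] -/
theorem goodStep_single_live (w : Sym2 (Fin n) → unitInterval) {o x b : Fin n} (A : Finset (Fin n))
    (hxo : x ≠ o) (hbo : b ≠ o) (hoA : o ∉ A)
    {F : Finset (Sym2 (Fin n))} (hF : ∀ e, e ∈ F ↔ o ∈ e ∧ ¬ e.IsDiag)
    {ξ : Set (Sym2 (Fin n))} (hξ : ∀ y : Fin n, s(o, y) ∈ ξ ↔ y ∈ ({x} : Finset (Fin n))) :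
    (prodBernoulli (pinW w ↑F ξ)).real ((⋃ a ∈ A, openConn o a) ∩ (openConn o b)ᶜ) =
      (prodBernoulli (fun e : Sym2 (Fin n) => if o ∈ e then (0 : unitInterval) else w e)).real
        ((⋃ a ∈ A, openConn x a) ∩ (openConn x b)ᶜ) := by
  refine goodStep_transfer w hF hξ
    (X' := (⋃ a ∈ A, openConnIn (({o} : Set (Fin n))ᶜ) x a) ∩ (openConnIn (({o} : Set (Fin n))ᶜ) x b)ᶜ)
    ((goodStep_determinedBy_biUnion A fun a _ =>
      Literature.Probability.Percolation.DCT16.determinedBy_openConnIn _ x a subset_rfl).inter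
      (goodStep_determinedBy_compl
        (Literature.Probability.Percolation.DCT16.determinedBy_openConnIn _ x b subset_rfl)))
    (fun ω hω => ?_) (fun ω hω => ?_)
  · have hω' : ∀ y : Fin n, y ≠ o → (s(o, y) ∈ ω ↔ y = x) := fun y hy => by
      rw [hω y hy, Finset.mem_singleton]
    simp only [Set.mem_inter_iff, Set.mem_iUnion, Set.mem_compl_iff, exists_prop]
    refine and_congr (exists_congr fun a => and_congr_right fun ha => ?_) (not_congr ?_)
    · exact goodStep_openConn_observer_iff_of_star_single hω' hxo fun h => hoA (h ▸ ha)
    · exact goodStep_openConn_observer_iff_of_star_single hω' hxo hbo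
  · simp only [Set.mem_inter_iff, Set.mem_iUnion, Set.mem_compl_iff, exists_prop]
    refine and_congr (exists_congr fun a => and_congr_right fun _ => ?_) (not_congr ?_)
    · exact goodStep_openConn_iff_of_isolated hω hxo
    · exact goodStep_openConn_iff_of_isolated hω hxo

/-- Pinned to the single pair `o–x`: connections between vertices other than `o` have the same
probability as in the star-deleted graph. [cite: KozmaNitzan2024, §3.2 p. 14 (proof of Thm 5)] -/
theorem goodStep_single_conn (w : Sym2 (Fin n) → unitInterval) {o x u v : Fin n}
    (huo : u ≠ o) (hvo : v ≠ o)
    {F : Finset (Sym2 (Fin n))} (hF : ∀ e, e ∈ F ↔ o ∈ e ∧ ¬ e.IsDiag)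
    {ξ : Set (Sym2 (Fin n))} (hξ : ∀ y : Fin n, s(o, y) ∈ ξ ↔ y ∈ ({x} : Finset (Fin n))) :
    (prodBernoulli (pinW w ↑F ξ)).real (openConn u v) =
      (prodBernoulli (fun e : Sym2 (Fin n) => if o ∈ e then (0 : unitInterval) else w e)).real
        (openConn u v) := by
  refine goodStep_transfer w hF hξ (X' := openConnIn (({o} : Set (Fin n))ᶜ) u v)
    (Literature.Probability.Percolation.DCT16.determinedBy_openConnIn _ u v subset_rfl)
    (fun ω hω => ?_) (fun ω hω => goodStep_openConn_iff_of_isolated hω huo)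
  have hω' : ∀ y : Fin n, y ≠ o → (s(o, y) ∈ ω ↔ y = x) := fun y hy => by
    rw [hω y hy, Finset.mem_singleton]
  exact goodStep_openConn_iff_of_star_single hω' huo hvo

/-- Pinned to the single pair `o–x` (`x ≠ o`): the pocket `{C(o) = W}` (`o ∈ W`) has the
probability of the pocket `{C(x) = W ∖ {o}}` in the star-deleted graph if `x ∈ W`.
[cite: KozmaNitzan2024, §3.2 p. 14 (proof of Thm 5)] -/
theorem goodStep_single_pocket (w : Sym2 (Fin n) → unitInterval) {o x : Fin n} (hxo : x ≠ o)
    (W : Finset (Fin n)) (hoW : o ∈ W)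
    {F : Finset (Sym2 (Fin n))} (hF : ∀ e, e ∈ F ↔ o ∈ e ∧ ¬ e.IsDiag)
    {ξ : Set (Sym2 (Fin n))} (hξ : ∀ y : Fin n, s(o, y) ∈ ξ ↔ y ∈ ({x} : Finset (Fin n))) :
    (prodBernoulli (pinW w ↑F ξ)).real {ω : BondConfig (Fin n) | openCluster ω o = (W : Set (Fin n))} =
      (prodBernoulli (fun e : Sym2 (Fin n) => if o ∈ e then (0 : unitInterval) else w e)).real
        {ω : BondConfig (Fin n) | openCluster ω x = ((W.erase o : Finset (Fin n)) : Set (Fin n))} := by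
  refine goodStep_transfer w hF hξ
    (X' := {ω : BondConfig (Fin n) |
      insert o {y | ω ∈ openConnIn (({o} : Set (Fin n))ᶜ) x y} = (W : Set (Fin n))})
    (goodStep_determinedBy_insertCluster o x _) (fun ω hω => ?_) (fun ω hω => ?_)
  · have hω' : ∀ y : Fin n, y ≠ o → (s(o, y) ∈ ω ↔ y = x) := fun y hy => by
      rw [hω y hy, Finset.mem_singleton]
    simp only [Set.mem_setOf_eq]
    rw [goodStep_openCluster_of_star_single hω' hxo]
  · simp only [Set.mem_setOf_eq]
    rw [goodStep_openCluster_of_isolated hω hxo, Finset.coe_erase]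
    have hoS : o ∉ {y | ω ∈ openConnIn (({o} : Set (Fin n))ᶜ) x y} := fun h => by
      obtain ⟨_, ho, _⟩ := h
      exact ho rfl
    constructor
    · intro h
      rw [h, Set.insert_sdiff_singleton, Set.insert_eq_of_mem (Finset.mem_coe.2 hoW)]
    · intro h
      rw [← h]
      ext y
      simp only [Set.mem_sdiff, Set.mem_insert_iff, Set.mem_singleton_iff]
      constructor
      · intro hy
        exact ⟨Or.inr hy, fun hyo => hoS (hyo ▸ hy)⟩
      · rintro ⟨hy | hy, hyo⟩
        · exact absurd hy hyo
        · exact hy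

/-- Pinned to the single pair `o–x`: a pocket `{C(o) = W}` with `x ∉ W` is null. [folklore] -/
theorem goodStep_single_pocket_null (w : Sym2 (Fin n) → unitInterval) {o x : Fin n} (hxo : x ≠ o)
    (W : Finset (Fin n)) (hxW : x ∉ W)
    {F : Finset (Sym2 (Fin n))} (hF : ∀ e, e ∈ F ↔ o ∈ e ∧ ¬ e.IsDiag)
    {ξ : Set (Sym2 (Fin n))} (hξ : ∀ y : Fin n, s(o, y) ∈ ξ ↔ y ∈ ({x} : Finset (Fin n))) :
    (prodBernoulli (pinW w ↑F ξ)).real {ω : BondConfig (Fin n) | openCluster ω o = (W : Set (Fin n))} =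
      0 := by
  rw [← measureReal_empty (μ := prodBernoulli (pinW w ↑F ξ))]
  refine measureReal_congr ?_
  filter_upwards [goodStep_pin_ae_star w hF hξ] with ω hω
  refine propext (iff_of_false (fun h => hxW ?_) (Set.notMem_empty ω))
  have hx : s(o, x) ∈ ω := (hω x hxo).2 (Finset.mem_singleton_self x)
  have hxC : x ∈ openCluster ω o := ((openGraph_adj ω o x).2 ⟨hx, hxo.symm⟩).reachable
  have h' : openCluster ω o = (W : Set (Fin n)) := h
  rw [h'] at hxC
  exact Finset.mem_coe.1 hxC

/-- Pinned to the single pair `o–x`: the avoidance probabilities `μ((sel ↔ b in Wᶜ)ᶜ)` (`o ∈ W`)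
agree with those of `W ∖ {o}` in the star-deleted graph. [folklore] -/
theorem goodStep_single_avoid (w : Sym2 (Fin n) → unitInterval) {o x u b : Fin n} (huo : u ≠ o)
    (W : Finset (Fin n)) (hoW : o ∈ W)
    {F : Finset (Sym2 (Fin n))} (hF : ∀ e, e ∈ F ↔ o ∈ e ∧ ¬ e.IsDiag)
    {ξ : Set (Sym2 (Fin n))} (hξ : ∀ y : Fin n, s(o, y) ∈ ξ ↔ y ∈ ({x} : Finset (Fin n))) :
    (prodBernoulli (pinW w ↑F ξ)).real (openConnIn ((↑W : Set (Fin n))ᶜ) u b)ᶜ =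
      (prodBernoulli (fun e : Sym2 (Fin n) => if o ∈ e then (0 : unitInterval) else w e)).real
        (openConnIn ((↑(W.erase o) : Set (Fin n))ᶜ) u b)ᶜ :=
  goodStep_transfer w hF hξ (X' := (openConnIn ((↑W : Set (Fin n))ᶜ) u b)ᶜ)
    (goodStep_determinedBy_compl (goodStep_determinedBy_openConnIn_compl W hoW u b))
    (fun _ _ => Iff.rfl) (fun _ hω => not_congr (goodStep_openConnIn_erase_of_isolated hω W huo))

/-- **The singleton branch.** Pinned to the single pair `o–x` (`x ≠ o`, `o ∉ A`, `b ≠ o`), the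
good-quadruple functional of the observer `o` at the designated level `1 − μ(a₀ ↔ b)` is bounded
by the good-quadruple functional of the observer `x` in the star-deleted graph at the same level
(with the selection `W' ↦ sel (insert o W')`), hence by the induction hypothesis.
[cite: KozmaNitzan2024, §3.2 p. 14 (proof of Thm 5)] -/
theorem goodStep_single (w : Sym2 (Fin n) → unitInterval) {o x b a₀ : Fin n} (A : Finset (Fin n))
    (hxo : x ≠ o) (hbo : b ≠ o) (hoA : o ∉ A) (ha₀o : a₀ ≠ o)
    (sel : Finset (Fin n) → Fin n) (hsel : ∀ W, sel W ∈ A)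
    {F : Finset (Sym2 (Fin n))} (hF : ∀ e, e ∈ F ↔ o ∈ e ∧ ¬ e.IsDiag)
    {ξ : Set (Sym2 (Fin n))} (hξ : ∀ y : Fin n, s(o, y) ∈ ξ ↔ y ∈ ({x} : Finset (Fin n)))
    (hIH : (prodBernoulli (fun e : Sym2 (Fin n) => if o ∈ e then (0 : unitInterval) else w e)).real
          ((⋃ a ∈ A, openConn x a) ∩ (openConn x b)ᶜ)
        + ∑ W ∈ (Finset.univ : Finset (Finset (Fin n))).filter (fun W => x ∈ W ∧ Disjoint W A),
            (prodBernoulli (fun e : Sym2 (Fin n) => if o ∈ e then (0 : unitInterval) else w e)).real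
                {ω : BondConfig (Fin n) | openCluster ω x = (W : Set (Fin n))}
              * (prodBernoulli (fun e : Sym2 (Fin n) => if o ∈ e then (0 : unitInterval) else w e)).real
                (openConnIn ((W : Set (Fin n))ᶜ) (sel (insert o W)) b)ᶜ
        ≤ 1 - (prodBernoulli (fun e : Sym2 (Fin n) => if o ∈ e then (0 : unitInterval) else w e)).real
          (openConn a₀ b)) :
    (prodBernoulli (pinW w ↑F ξ)).real ((⋃ a ∈ A, openConn o a) ∩ (openConn o b)ᶜ)
      + ∑ W ∈ (Finset.univ : Finset (Finset (Fin n))).filter (fun W => o ∈ W ∧ Disjoint W A),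
          (prodBernoulli (pinW w ↑F ξ)).real {ω : BondConfig (Fin n) | openCluster ω o = (W : Set (Fin n))}
            * (prodBernoulli (pinW w ↑F ξ)).real (openConnIn ((W : Set (Fin n))ᶜ) (sel W) b)ᶜ
      ≤ 1 - (prodBernoulli (pinW w ↑F ξ)).real (openConn a₀ b) := by
  -- abbreviate the summand of the star-deleted side
  obtain ⟨hf, hhf⟩ : ∃ hf : Finset (Fin n) → ℝ, ∀ W' : Finset (Fin n), hf W' =
      (prodBernoulli (fun e : Sym2 (Fin n) => if o ∈ e then (0 : unitInterval) else w e)).real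
          {ω : BondConfig (Fin n) | openCluster ω x = (W' : Set (Fin n))}
        * (prodBernoulli (fun e : Sym2 (Fin n) => if o ∈ e then (0 : unitInterval) else w e)).real
          (openConnIn ((W' : Set (Fin n))ᶜ) (sel (insert o W')) b)ᶜ := ⟨_, fun _ => rfl⟩
  simp only [← hhf] at hIH
  rw [goodStep_single_live w A hxo hbo hoA hF hξ, goodStep_single_conn w ha₀o hbo hF hξ]
  suffices hsum :
      ∑ W ∈ (Finset.univ : Finset (Finset (Fin n))).filter (fun W => o ∈ W ∧ Disjoint W A),
          (prodBernoulli (pinW w ↑F ξ)).real {ω : BondConfig (Fin n) | openCluster ω o = (W : Set (Fin n))}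
            * (prodBernoulli (pinW w ↑F ξ)).real (openConnIn ((W : Set (Fin n))ᶜ) (sel W) b)ᶜ ≤
        ∑ W ∈ (Finset.univ : Finset (Finset (Fin n))).filter (fun W => x ∈ W ∧ Disjoint W A), hf W by
    linarith [hsum, hIH]
  -- the pocket sums: drop the pockets missing `x`, re-index by `W ↦ W.erase o`
  have hzero : ∀ W ∈ (Finset.univ : Finset (Finset (Fin n))).filter (fun W => o ∈ W ∧ Disjoint W A),
      (prodBernoulli (pinW w ↑F ξ)).real {ω : BondConfig (Fin n) | openCluster ω o = (W : Set (Fin n))}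
          * (prodBernoulli (pinW w ↑F ξ)).real (openConnIn ((W : Set (Fin n))ᶜ) (sel W) b)ᶜ ≠ 0 →
        x ∈ W := by
    intro W _ hne
    by_contra hxW
    exact hne (by rw [goodStep_single_pocket_null w hxo W hxW hF hξ, zero_mul])
  rw [← Finset.sum_filter_of_ne hzero, Finset.filter_filter]
  have hterm : ∀ W ∈ (Finset.univ : Finset (Finset (Fin n))).filter
      (fun W => (o ∈ W ∧ Disjoint W A) ∧ x ∈ W),
      (prodBernoulli (pinW w ↑F ξ)).real {ω : BondConfig (Fin n) | openCluster ω o = (W : Set (Fin n))}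
          * (prodBernoulli (pinW w ↑F ξ)).real (openConnIn ((W : Set (Fin n))ᶜ) (sel W) b)ᶜ =
        hf (W.erase o) := by
    intro W hW
    obtain ⟨⟨hoW, -⟩, -⟩ := (Finset.mem_filter.1 hW).2
    rw [hhf, goodStep_single_pocket w hxo W hoW hF hξ,
      goodStep_single_avoid w (ne_of_mem_of_not_mem (hsel W) hoA) W hoW hF hξ, Finset.insert_erase hoW]
  have hinj : Set.InjOn (fun W : Finset (Fin n) => W.erase o)
      ↑((Finset.univ : Finset (Finset (Fin n))).filter (fun W => (o ∈ W ∧ Disjoint W A) ∧ x ∈ W)) := by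
    intro W₁ hW₁ W₂ hW₂ h
    have h₁ := (Finset.mem_filter.1 (Finset.mem_coe.1 hW₁)).2.1.1
    have h₂ := (Finset.mem_filter.1 (Finset.mem_coe.1 hW₂)).2.1.1
    have h' : W₁.erase o = W₂.erase o := h
    rw [← Finset.insert_erase h₁, ← Finset.insert_erase h₂, h']
  rw [Finset.sum_congr rfl hterm, ← Finset.sum_image hinj]
  refine Finset.sum_le_sum_of_subset_of_nonneg (fun W' hW' => ?_) fun W' _ _ => ?_
  · obtain ⟨W, hW, rfl⟩ := Finset.mem_image.1 hW'
    obtain ⟨⟨-, hWA⟩, hxW⟩ := (Finset.mem_filter.1 hW).2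
    exact Finset.mem_filter.2 ⟨Finset.mem_univ _, Finset.mem_erase.2 ⟨hxo, hxW⟩,
      Finset.disjoint_of_subset_left (Finset.erase_subset o W) hWA⟩
  · rw [hhf]
    exact mul_nonneg measureReal_nonneg measureReal_nonneg

/-! ### Registered waypoint (siege k32) -/

/-- Registered sub-goal `stub_goodStepSingleton_k32` of stmt-CriticalPhenomena-4576 (siege k32 on
`stub_goodStep`): **the singleton branch** — with the star of `o` pinned to the single pair `o–x`,
the good-quadruple functional of `o` at the designated level `1 − μ(a₀ ↔ b)` is bounded by the
functional of the observer `x` in the star-deleted graph (selection `W' ↦ sel (insert o W')`) at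
the same level, i.e. by the induction hypothesis of `stub_goodStep`.
[cite: KozmaNitzan2024, §3.2 p. 14 (proof of Thm 5)] -/
theorem stub_goodStepSingleton_k32 :
    ∀ (n : ℕ) (w : Sym2 (Fin n) → unitInterval) (A : Finset (Fin n)) (o x b a₀ : Fin n)
      (sel : Finset (Fin n) → Fin n),
      x ≠ o → b ≠ o → o ∉ A → a₀ ≠ o → (∀ W, sel W ∈ A) →
      ((prodBernoulli (fun e : Sym2 (Fin n) => if o ∈ e then (0 : unitInterval) else w e)).real
          ((⋃ a ∈ A, openConn x a) ∩ (openConn x b)ᶜ)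
        + ∑ W ∈ (Finset.univ : Finset (Finset (Fin n))).filter (fun W => x ∈ W ∧ Disjoint W A),
            (prodBernoulli (fun e : Sym2 (Fin n) => if o ∈ e then (0 : unitInterval) else w e)).real
                {ω : BondConfig (Fin n) | openCluster ω x = (W : Set (Fin n))}
              * (prodBernoulli (fun e : Sym2 (Fin n) => if o ∈ e then (0 : unitInterval) else w e)).real
                (openConnIn ((W : Set (Fin n))ᶜ) (sel (insert o W)) b)ᶜ
        ≤ 1 - (prodBernoulli (fun e : Sym2 (Fin n) => if o ∈ e then (0 : unitInterval) else w e)).real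
          (openConn a₀ b)) →
      (prodBernoulli (pinW w ↑(Finset.univ.filter fun e : Sym2 (Fin n) => o ∈ e ∧ ¬ e.IsDiag)
          ((fun y : Fin n => s(o, y)) '' (↑({x} : Finset (Fin n)) : Set (Fin n))))).real
          ((⋃ a ∈ A, openConn o a) ∩ (openConn o b)ᶜ)
        + ∑ W ∈ (Finset.univ : Finset (Finset (Fin n))).filter (fun W => o ∈ W ∧ Disjoint W A),
            (prodBernoulli (pinW w ↑(Finset.univ.filter fun e : Sym2 (Fin n) => o ∈ e ∧ ¬ e.IsDiag)
                ((fun y : Fin n => s(o, y)) '' (↑({x} : Finset (Fin n)) : Set (Fin n))))).real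
                {ω : BondConfig (Fin n) | openCluster ω o = (W : Set (Fin n))}
              * (prodBernoulli (pinW w ↑(Finset.univ.filter fun e : Sym2 (Fin n) => o ∈ e ∧ ¬ e.IsDiag)
                ((fun y : Fin n => s(o, y)) '' (↑({x} : Finset (Fin n)) : Set (Fin n))))).real
                (openConnIn ((W : Set (Fin n))ᶜ) (sel W) b)ᶜ
        ≤ 1 - (prodBernoulli (pinW w ↑(Finset.univ.filter fun e : Sym2 (Fin n) => o ∈ e ∧ ¬ e.IsDiag)
          ((fun y : Fin n => s(o, y)) '' (↑({x} : Finset (Fin n)) : Set (Fin n))))).real (openConn a₀ b) := by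
  intro n w A o x b a₀ sel hxo hbo hoA ha₀o hsel hIH
  exact goodStep_single w A hxo hbo hoA ha₀o sel hsel
    (F := Finset.univ.filter fun e : Sym2 (Fin n) => o ∈ e ∧ ¬ e.IsDiag) (fun e => by simp)
    (fun y => by
      rw [Function.Injective.mem_set_image fun y y' h => Sym2.congr_right.1 h, Finset.mem_coe]) hIH

end

end Summit.CriticalPhenomena.PercolationContinuityZ3.Theorems
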